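import Summits.ResolutionOfSingularities.ResolutionOfSingularities.Theorems.FrobeniusClosingDefs

/-!
# Stub `stub_arena` of crux `ClosingReduction` (line `chart-factorization`), part 1 of 3:
# the coefficient calculus over a ring, and the DEFINITIONS of the arena

Crux `stmt-ResolutionOfSingularities-16347` (`Theses/FrobeniusClosing.lean`, item `ClosingReduction`);
the named dynamics and the statement `ArenaE` are in `Theorems/FrobeniusClosingDefs.lean`. Helper
sub-namespace `ArenaProof`. This part carries every `def` of the stub (parts 2–3 are proofs).

* § 1 — the route's coefficient calculus (`clean`, `bl`, `dv`, `tr`, and the `p`-branch of `step`)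
  re-declared VERBATIM over an arbitrary commutative ring `R`: `cleanR`, `blR`, `dvR`, `trR`, the
  composite `succR = cleanR ∘ trR i τ p ∘ dvR i p ∘ blR i ∘ cleanR`, and the polynomial states
  `stateR` (jet block + buffer block) carried by the vertices. Over a field they ARE the route's
  operators (`step_eq_succR` is `unfold; rw [if_pos]; rfl`), so the successor coefficients can be
  computed ONCE in a polynomial ring over `ℤ/p` and specialised by ring homomorphisms (part 2).
* § 3 — order lemmas after `Cruxes/ClosingReduction/Disproof.lean` § (b) (copied, not imported) and
  the anchor `arena_step_eq_of_multP`: on a multiplicity-`p` state the `ite` of `step` takes its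
  `p`-branch.
* § 4 — layout of a vertex `(x, w) ∈ K^N × K^M`, `M = Msz n N₂ M_L = N₂ + n + M_L + M_L`: jet code `x`,
  witness block `w = (z, τ, wx, wy)` (buffer, translation, Loewy witnesses of the two jets).
* § 5 — the universal state `univState`, the UNIVERSAL SUCCESSOR POLYNOMIALS `Phi j s ∈ (ℤ/p)[v, v']`
  (the calculus run once on the universal buffered state), and the system: `Psys j` = Loewy system
  `G` of `LoewyKit` (3) for both jets (renamed copies) ∪ shape equations (no recorded coefficient
  below degree `p`) ∪ successor equations `y s = Phi j s`; `Qsys` = `{x s · y s'}` (both jets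
  non-zero).
-/

noncomputable section

-- single-problem summit: the doubled namespace component `ResolutionOfSingularities` is forced
set_option linter.dupNamespace false

open scoped BigOperators Classical

namespace Summit.ResolutionOfSingularities.ResolutionOfSingularities.Theorems.FrobeniusClosing

namespace ArenaProof

/-! ## 1. The coefficient calculus over an arbitrary commutative ring -/

section Generic

variable (p n : ℕ) (R : Type) [CommRing R]

/-- `cleanR`: the route's `clean` with coefficients in a commutative ring `R` (same body). [folklore] -/
def cleanR (c : (Fin n → ℕ) → R) : (Fin n → ℕ) → R :=
  fun A => @ite R (∀ j, p ∣ A j) (Classical.dec _) 0 (c A)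

/-- `blR`: the route's blow-up chart `bl` with coefficients in `R` (same body). [folklore] -/
def blR (i : Fin n) (c : (Fin n → ℕ) → R) : (Fin n → ℕ) → R :=
  fun B => @ite R (Finset.sum (Finset.univ.erase i) (fun j => B j) ≤ B i) (Classical.dec _)
    (c (Function.update B i (B i - Finset.sum (Finset.univ.erase i) (fun j => B j)))) 0

/-- `dvR`: the route's division `dv` with coefficients in `R` (same body). [folklore] -/
def dvR (i : Fin n) (s : ℕ) (c : (Fin n → ℕ) → R) : (Fin n → ℕ) → R :=
  fun B => c (Function.update B i (B i + s))

/-- `trR`: the route's Taylor shift `tr` with coefficients in `R` (same body). [folklore] -/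
def trR (i : Fin n) (τ : Fin n → R) (s : ℕ) (c : (Fin n → ℕ) → R) : (Fin n → ℕ) → R :=
  fun B => Finset.sum (Fintype.piFinset (fun _ : Fin n => Finset.range (B i + s + 1)))
    (fun D => @ite R (D i = 0) (Classical.dec _) (c (B + D) * Finset.prod (Finset.univ.erase i)
      (fun j => ((Nat.choose (B j + D j) (B j) : ℕ) : R) * τ j ^ (D j))) 0)

/-- `succR i τ c`: the `p`-branch of the route's `step` over `R` — clean, blow up (chart `i`), divide
by `u_i ^ p`, translate to `τ`, clean. [folklore] -/
def succR (i : Fin n) (τ : Fin n → R) (c : (Fin n → ℕ) → R) : (Fin n → ℕ) → R :=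
  cleanR p n R (trR n R i τ p (dvR n R i p (blR n R i (cleanR p n R c))))

/-- `stateR e e₂ x z`: the polynomial state with coefficient `x s` at `e s`, `z t` at `e₂ t` and `0`
elsewhere (the jet block followed by the buffer block). [folklore] -/
def stateR {N N₂ : ℕ} (e : Fin N → (Fin n → ℕ)) (e₂ : Fin N₂ → (Fin n → ℕ)) (x : Fin N → R)
    (z : Fin N₂ → R) : (Fin n → ℕ) → R :=
  fun A => @dite R (∃ s, e s = A) (Classical.dec _) (fun h => x (Classical.choose h))
    (fun _ => @dite R (∃ t, e₂ t = A) (Classical.dec _) (fun h => z (Classical.choose h))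
      (fun _ => 0))

end Generic

/-! ## 2. Over a field the generic calculus is the route's calculus (`rfl`) -/

section FieldAgree

variable {p n : ℕ} {K : Type} [Field K]

/-- The `p`-branch of `step`: when the cleaned order is `≥ p`, `step = succR` (the generic operators
over a field ARE the route's, by `rfl`). [folklore] -/
theorem step_eq_succR (i : Fin n) (τ : Fin n → K) {c : (Fin n → ℕ) → K}
    (h : p ≤ ord n K (clean p n K c)) : step p n K i τ c = succR p n K i τ c := by
  unfold step succR
  rw [if_pos h]
  rfl

end FieldAgree

/-! ## 3. Order and multiplicity (after `Cruxes/ClosingReduction/Disproof.lean` § (b)) -/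

section Order

variable {p n : ℕ} {K : Type} [Field K]

/-- `clean` is idempotent. [folklore] -/
theorem clean_clean (c : (Fin n → ℕ) → K) : clean p n K (clean p n K c) = clean p n K c := by
  funext A
  unfold clean
  split_ifs <;> rfl

/-- A coefficient surviving `clean` sits at a non-`p`-th-power monomial and is a coefficient of
`c`. [folklore] -/
theorem clean_ne_zero {c : (Fin n → ℕ) → K} {A : Fin n → ℕ} (h : clean p n K c A ≠ 0) :
    c A ≠ 0 ∧ ¬ ∀ j, p ∣ A j := by
  unfold clean at h
  split_ifs at h with hd
  · exact (h rfl).elim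
  · exact ⟨h, hd⟩

/-- `clean c A = c A` at a non-`p`-th-power monomial. [folklore] -/
theorem clean_of_not_dvd {c : (Fin n → ℕ) → K} {A : Fin n → ℕ} (h : ¬ ∀ j, p ∣ A j) :
    clean p n K c A = c A := by
  unfold clean
  rw [if_neg h]

/-- `clean c A = 0` at a `p`-th-power monomial. [folklore] -/
theorem clean_of_dvd {c : (Fin n → ℕ) → K} {A : Fin n → ℕ} (h : ∀ j, p ∣ A j) :
    clean p n K c A = 0 := by
  unfold clean
  rw [if_pos h]

/-- Successor states are cleaned. [folklore] -/
theorem clean_step (i : Fin n) (τ : Fin n → K) (c : (Fin n → ℕ) → K) :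
    clean p n K (step p n K i τ c) = step p n K i τ c := by
  unfold step
  exact clean_clean _

/-- With `MultP`, the cleaned order is `≥ p`. [folklore] -/
theorem le_ord_clean_of_multP {c : (Fin n → ℕ) → K} (h : MultP p n K c) :
    p ≤ ord n K (clean p n K c) := by
  obtain ⟨⟨A₀, hA₀⟩, hmin⟩ := h
  unfold ord
  have hne : {m : ℕ | ∃ A, clean p n K c A ≠ 0 ∧
      m = Finset.sum Finset.univ (fun j => A j)}.Nonempty :=
    ⟨_, A₀, hA₀, rfl⟩
  obtain ⟨A, hA, hm⟩ := Nat.sInf_mem hne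
  rw [hm]
  exact hmin A hA

/-- With `MultP`, `step` takes its `p`-branch: `step i τ c = succR i τ c`. [folklore] -/
theorem step_eq_succR_of_multP (i : Fin n) (τ : Fin n → K) {c : (Fin n → ℕ) → K}
    (h : MultP p n K c) : step p n K i τ c = succR p n K i τ c :=
  step_eq_succR i τ (le_ord_clean_of_multP h)

end Order

/-! ## 4. Layout of a vertex: jet block `x ∈ Kᴺ`, then the witness block
`w = (z, τ, wx, wy) ∈ K^{N₂} × Kⁿ × K^{M_L} × K^{M_L}` -/

section Layout

variable (n N₂ ML : ℕ)

/-- Size of the witness block: buffer `z` (`N₂`), translation `τ` (`n`), Loewy witnesses of the two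
jets (`M_L` each). [folklore] -/
abbrev Msz : ℕ := N₂ + n + ML + ML

/-- Position of the buffer coordinate `z t` in the witness block. [folklore] -/
def zIdx (t : Fin N₂) : Fin (Msz n N₂ ML) := Fin.castAdd ML (Fin.castAdd ML (Fin.castAdd n t))

/-- Position of the translation coordinate `τ l` in the witness block. [folklore] -/
def tauIdx (l : Fin n) : Fin (Msz n N₂ ML) := Fin.castAdd ML (Fin.castAdd ML (Fin.natAdd N₂ l))

/-- Position of the Loewy witness `wx t` of the first jet in the witness block. [folklore] -/
def wxIdx (t : Fin ML) : Fin (Msz n N₂ ML) := Fin.castAdd ML (Fin.natAdd (N₂ + n) t)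

/-- Position of the Loewy witness `wy t` of the second jet in the witness block. [folklore] -/
def wyIdx (t : Fin ML) : Fin (Msz n N₂ ML) := Fin.natAdd (N₂ + n + ML) t

variable {n N₂ ML} {K : Type}

/-- The witness block assembled from its four parts. [folklore] -/
def witness (z : Fin N₂ → K) (τ : Fin n → K) (wx wy : Fin ML → K) : Fin (Msz n N₂ ML) → K :=
  Fin.append (Fin.append (Fin.append z τ) wx) wy

/-- Reading `z` off the witness block. [folklore] -/
@[simp] theorem witness_zIdx (z : Fin N₂ → K) (τ : Fin n → K) (wx wy : Fin ML → K) (t : Fin N₂) :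
    witness z τ wx wy (zIdx n N₂ ML t) = z t := by
  simp [witness, zIdx]

/-- Reading `τ` off the witness block. [folklore] -/
@[simp] theorem witness_tauIdx (z : Fin N₂ → K) (τ : Fin n → K) (wx wy : Fin ML → K) (l : Fin n) :
    witness z τ wx wy (tauIdx n N₂ ML l) = τ l := by
  simp [witness, tauIdx]

/-- Reading `wx` off the witness block. [folklore] -/
@[simp] theorem witness_wxIdx (z : Fin N₂ → K) (τ : Fin n → K) (wx wy : Fin ML → K) (t : Fin ML) :
    witness z τ wx wy (wxIdx n N₂ ML t) = wx t := by
  simp [witness, wxIdx]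

/-- Reading `wy` off the witness block. [folklore] -/
@[simp] theorem witness_wyIdx (z : Fin N₂ → K) (τ : Fin n → K) (wx wy : Fin ML → K) (t : Fin ML) :
    witness z τ wx wy (wyIdx n N₂ ML t) = wy t := by
  simp [witness, wyIdx]

end Layout

/-! ## 5. The universal successor polynomials and the system `(P, Q)` -/

section System

variable (p n N N₂ ML : ℕ) (e : Fin N → (Fin n → ℕ)) (e₂ : Fin N₂ → (Fin n → ℕ))
  (G : Finset (MvPolynomial (Fin N ⊕ Fin ML) (ZMod p)))

/-- The coefficient ring of the universal state: polynomials over `ℤ/p` in the coordinates of an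
edge `(v, v') ∈ 𝔸^{N+M} × 𝔸^{N+M}`. [folklore] -/
abbrev Poly : Type :=
  MvPolynomial (Fin (N + Msz n N₂ ML) ⊕ Fin (N + Msz n N₂ ML)) (ZMod p)

/-- The UNIVERSAL STATE: coefficient `X (inl s)` at the recorded monomial `e s`, the buffer variable
`X (inl (z-position t))` at `e₂ t`, `0` elsewhere. [folklore] -/
def univState : (Fin n → ℕ) → Poly p n N N₂ ML :=
  stateR n (Poly p n N N₂ ML) e e₂
    (fun s => MvPolynomial.X (Sum.inl (Fin.castAdd (Msz n N₂ ML) s)))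
    (fun t => MvPolynomial.X (Sum.inl (Fin.natAdd N (zIdx n N₂ ML t))))

/-- The UNIVERSAL TRANSLATION: `τ l` is the variable at the `τ`-position `l` of the first vertex.
[folklore] -/
def univTau : Fin n → Poly p n N N₂ ML :=
  fun l => MvPolynomial.X (Sum.inl (Fin.natAdd N (tauIdx n N₂ ML l)))

/-- The UNIVERSAL SUCCESSOR COEFFICIENT `Φ j s`: the coefficient at `e s` of the successor in chart
`j` of the universal state, a polynomial over `ℤ/p`. [folklore] -/
def Phi (j : Fin n) (s : Fin N) : Poly p n N N₂ ML :=
  succR p n (Poly p n N N₂ ML) j (univTau p n N N₂ ML) (univState p n N N₂ ML e e₂) (e s)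

/-- Renaming of the Loewy system into the coordinates `(x, wx)` of the first vertex. [folklore] -/
def rhoX : Fin N ⊕ Fin ML → Fin (N + Msz n N₂ ML) ⊕ Fin (N + Msz n N₂ ML) :=
  Sum.elim (fun s => Sum.inl (Fin.castAdd (Msz n N₂ ML) s))
    (fun t => Sum.inl (Fin.natAdd N (wxIdx n N₂ ML t)))

/-- Renaming of the Loewy system into the jet `y` of the SECOND vertex and the witnesses `wy` of
the FIRST vertex. [folklore] -/
def rhoY : Fin N ⊕ Fin ML → Fin (N + Msz n N₂ ML) ⊕ Fin (N + Msz n N₂ ML) :=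
  Sum.elim (fun s => Sum.inr (Fin.castAdd (Msz n N₂ ML) s))
    (fun t => Sum.inl (Fin.natAdd N (wyIdx n N₂ ML t)))

/-- The equations `P j` of the piece "the move was made in chart `j`": Loewy system for both jets,
shape equations (no recorded coefficient below degree `p`) for both jets, and the successor
equations `y s = Φ j s`. [folklore] -/
def Psys (j : Fin n) : Finset (Poly p n N N₂ ML) :=
  G.image (MvPolynomial.rename (rhoX n N N₂ ML)) ∪
  G.image (MvPolynomial.rename (rhoY n N N₂ ML)) ∪
  (Finset.univ.filter (fun s : Fin N => Finset.sum Finset.univ (fun j => e s j) < p)).image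
    (fun s => MvPolynomial.X (Sum.inl (Fin.castAdd (Msz n N₂ ML) s))) ∪
  (Finset.univ.filter (fun s : Fin N => Finset.sum Finset.univ (fun j => e s j) < p)).image
    (fun s => MvPolynomial.X (Sum.inr (Fin.castAdd (Msz n N₂ ML) s))) ∪
  Finset.univ.image (fun s : Fin N =>
    MvPolynomial.X (Sum.inr (Fin.castAdd (Msz n N₂ ML) s)) - Phi p n N N₂ ML e e₂ j s)

/-- The inequations `Q j` (the same for every piece): some `x s · y s' ≠ 0`, i.e. both jets are
non-zero. [folklore] -/
def Qsys (_j : Fin n) : Finset (Poly p n N N₂ ML) :=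
  (Finset.univ ×ˢ Finset.univ).image (fun ss' : Fin N × Fin N =>
    MvPolynomial.X (Sum.inl (Fin.castAdd (Msz n N₂ ML) ss'.1)) *
      MvPolynomial.X (Sum.inr (Fin.castAdd (Msz n N₂ ML) ss'.2)))

end System

end ArenaProof

/-- **Anchor of part 1 of stub `stub_arena`** — the `p`-branch of the route's `step`: on a state of
multiplicity `p` one move of the dynamics is `clean ∘ tr i τ p ∘ dv i p ∘ bl i ∘ clean`. [folklore] -/
theorem arena_step_eq_of_multP {p n : ℕ} {K : Type} [Field K] (i : Fin n) (τ : Fin n → K)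
    {c : (Fin n → ℕ) → K} (h : MultP p n K c) :
    step p n K i τ c =
      clean p n K (tr n K i τ p (dv n K i p (bl n K i (clean p n K c)))) :=
  ArenaProof.step_eq_succR_of_multP i τ h

end Summit.ResolutionOfSingularities.ResolutionOfSingularities.Theorems.FrobeniusClosing
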